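import Mathlib.LinearAlgebra.Basis.VectorSpace
import Mathlib.Analysis.Complex.Basic
import HarnessLib

/-!
# Base change `ℚ → ℂ` for linear relations: complex solutions of rational systems

Topic: `Literature/NumberTheory/Transcendental`. A small linear-algebra brick of the discharge of the
named fact `Literature.NumberTheory.Transcendental.philippon1986_std` (classification of the
obstruction subgroups of Philippon's zero estimate; the abelian datum of an algebraic subgroup of
`E^γ` is RATIONAL and one has to pass between "cut out by rational equations" and "spanned by
rational vectors"). For a set `S ⊆ ℚ^γ` of rational vectors:

* `Rat.mem_span_ratVec_of_forall_sum_eq_zero` — a complex vector `x` orthogonal to `S`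
  (`∑_b s_b x_b = 0` for `s ∈ S`) is a complex combination of RATIONAL vectors orthogonal to `S`.

Proof: expand the coordinates of `x` in a `ℚ`-basis `(e_k)` of `ℂ`, `x = ∑_k e_k x^{(k)}` with
`x^{(k)} ∈ ℚ^γ`; then `0 = ⟨s, x⟩ = ∑_k e_k ⟨s, x^{(k)}⟩` with rational `⟨s, x^{(k)}⟩` forces
`⟨s, x^{(k)}⟩ = 0` for every `k`. (Both directions of the base change — complex solutions of a
rational system are spanned by rational solutions, complex relations of a rationally spanned
subspace are spanned by rational relations — are this statement, the pairing being symmetric.)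
Everything is PROVED; the only definition is `ratVec`.

## References

* N. Bourbaki, *Algebra II*, Ch. II §8 no. 4 (extension of scalars and solutions of linear
  systems). [folklore]
-/

noncomputable section

open Module

namespace Literature.NumberTheory.Transcendental

namespace Rat

variable {γ : Type} [Fintype γ]

/-- A rational vector read in `ℂ^γ`. [folklore] -/
def ratVec (v : γ → ℚ) : γ → ℂ := fun b => (v b : ℂ)

omit [Fintype γ] in
/-- Unfolding `ratVec`. [folklore] -/
@[simp] theorem ratVec_apply (v : γ → ℚ) (b : γ) : ratVec v b = (v b : ℂ) := rfl

/-- **Base change for orthogonality relations.** A complex vector orthogonal to a set `S` of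
rational vectors is a complex linear combination of rational vectors orthogonal to `S`. [folklore] -/
theorem mem_span_ratVec_of_forall_sum_eq_zero (S : Set (γ → ℚ)) {x : γ → ℂ}
    (hx : ∀ s ∈ S, ∑ b, (s b : ℂ) * x b = 0) :
    x ∈ Submodule.span ℂ (ratVec '' {v : γ → ℚ | ∀ s ∈ S, ∑ b, s b * v b = 0}) := by
  classical
  -- a `ℚ`-basis of `ℂ` and the rational components of `x`
  let B := Basis.ofVectorSpace ℚ ℂ
  let comp : Basis.ofVectorSpaceIndex ℚ ℂ → γ → ℚ := fun k b => B.repr (x b) k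
  let K : Finset (Basis.ofVectorSpaceIndex ℚ ℂ) := (Finset.univ : Finset γ).biUnion fun b => (B.repr (x b)).support
  -- `x = ∑_{k ∈ K} e_k • comp k`
  have hx_eq : x = ∑ k ∈ K, (B k : ℂ) • ratVec (comp k) := by
    funext b
    simp only [Finset.sum_apply, Pi.smul_apply, smul_eq_mul, ratVec_apply]
    -- `x b = ∑_{k ∈ support} repr k • e_k`, extended to `K`
    have hsub : (B.repr (x b)).support ⊆ K :=
      Finset.subset_biUnion_of_mem (fun b' => (B.repr (x b')).support) (Finset.mem_univ b)
    calc x b = ∑ k ∈ (B.repr (x b)).support, (B.repr (x b) k : ℚ) • (B k : ℂ) := by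
            conv_lhs => rw [← B.linearCombination_repr (x b)]
            rfl
      _ = ∑ k ∈ K, (B.repr (x b) k : ℚ) • (B k : ℂ) := by
            refine Finset.sum_subset hsub fun k _ hk => ?_
            rw [Finsupp.notMem_support_iff.mp hk, zero_smul]
      _ = ∑ k ∈ K, (B k : ℂ) * ((comp k b : ℚ) : ℂ) := by
            refine Finset.sum_congr rfl fun k _ => ?_
            rw [Rat.smul_def, mul_comm]
  -- each rational component is orthogonal to `S`
  have hcomp : ∀ k ∈ K, ∀ s ∈ S, ∑ b, s b * comp k b = 0 := by
    intro k hk s hs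
    -- `0 = ⟨s, x⟩ = ∑_{k ∈ K} e_k • ⟨s, comp k⟩` and the `e_k` are `ℚ`-independent
    have hsum : ∑ k' ∈ K, (∑ b, s b * comp k' b : ℚ) • (B k' : ℂ) = 0 := by
      have h0 := hx s hs
      rw [hx_eq] at h0
      rw [← h0]
      simp only [Finset.sum_apply, Pi.smul_apply, smul_eq_mul, ratVec_apply, Finset.mul_sum, Rat.smul_def]
      rw [Finset.sum_comm]
      refine Finset.sum_congr rfl fun b _ => ?_
      push_cast
      rw [Finset.sum_mul]
      refine Finset.sum_congr rfl fun k' _ => ?_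
      ring
    have hli := B.linearIndependent
    rw [linearIndependent_iff'] at hli
    exact hli K (fun k' => ∑ b, s b * comp k' b) hsum k hk
  -- conclude
  rw [hx_eq]
  exact Submodule.sum_mem _ fun k hk => Submodule.smul_mem _ _ (Submodule.subset_span ⟨comp k, hcomp k hk, rfl⟩)

end Rat

end Literature.NumberTheory.Transcendental

end
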